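import Summits.CriticalPhenomena.PercolationContinuityZ3.Theorems.PercNearOneGluingNoHeavyLowerTailKnQuestion8CoefficientwiseApex
import HarnessLib

/-!
# z-locality of the POINT ROW of the coefficientwise first rung (prim-lf-2 gen 33)

Support file (`--supports stmt-CriticalPhenomena-4575`, closed), prover `prim-lf-2` (gen 33).  No definitions, no named facts, no sorries; standard axioms.
Memo `prim-lf-2/CW-LOCALITY-gen33.md`; notation of `prim-lf-2/CW-PROGRAMME-gen21.md` and `prim-lf-2/CW-POINTS-gen32.md`.

For a finite multigraph `ends : ι → Sym2 V` on an edge set `E`, a root `x`, a wall vertex `z` and the uniform two-colouring `s ⊔ (E ∖ s)` of `E`, write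
`K s = C_x(s)` (red cluster of `x`), `K (E ∖ s)` (blue cluster), `W_E = {s ⊆ E : z ∉ K s, z ∉ K (E ∖ s)}` (no monochromatic `x–z` path) and, for a vertex
`u`, `σ_u(s) = 1[u ∈ K s] − 1[u ∈ K (E ∖ s)] ∈ {−1, 0, 1}`.  The POINT ROW of CW-PA (the first rung of prim-lf-2's coefficientwise programme, specialised
to the point functionals `f = 1_u`, `g = 1_w`) is `0 ≤ Σ_{s ∈ W_E} σ_u(s) σ_w(s)` (CW-POINTS-gen32).
* `Coefficientwise.not_mem_openCluster_insert_zEdge_iff`, `Coefficientwise.openCluster_insert_zEdge_eq` — adding an edge `{z, u}` keeps `z` outside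
  `C_x` iff `z ∉ C_x` and `u ∉ C_x`, and then `C_x` is unchanged.
* `Coefficientwise.pointRow_erase_zEdge` — **z-LOCALITY**: for EVERY `g : Set V → ℝ`, erasing an edge `e` with ends `{z, u}` does not change
  `Σ_{s ∈ W_E} σ_u(s)·(g(K s) − g(K(E ∖ s)))` (the factor `(2 − a_u − b_u)` produced by resolving the colour of `e` acts as the identity on `σ_u`).
* `Coefficientwise.pointRow_sdiff_zEdges` — the same for any set of edges with ends `{z, u}`.
* `Coefficientwise.pointRow_nonneg_of_zEdges` — COROLLARY: if every edge at `z` has ends `{z,u}` or `{z,w}` then the `(u,w)` point row holds: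
  `0 ≤ Σ_{s ∈ W_E} σ_u σ_w` (after erasure the wall is vacuous and the sum is `Coefficientwise.harris_twoColouring_powerset`).
* `Coefficientwise.pointRow_univ_nonneg_of_zEdges` — the same over all colourings of `ι` (`E = univ`, `E ∖ s = sᶜ`).
[cite: KozmaNitzan2024, Questions 8–9 (§5.5 p. 36) (context: the Question-8 pocket covariance programme)]
-/

namespace Summit.CriticalPhenomena.PercolationContinuityZ3.Theorems

open Finset Literature.Probability.Percolation

namespace Coefficientwise

variable {ι V : Type*} (ends : ι → Sym2 V)

section graph

variable [DecidableEq ι]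

open Classical in
/-- Adding an edge `e = {z, u}` to a colouring `B` with `z ∉ C_x(B)` and `u ∉ C_x(B)` does not change the cluster of `x`.
[cite: KozmaNitzan2024, §5.5 (context only; folklore)] -/
theorem openCluster_insert_zEdge_eq {B : Finset ι} {e : ι} {x z u : V} (he : ends e = s(z, u))
    (hz : z ∉ openCluster (ends '' (↑B : Set ι)) x) (hu : u ∉ openCluster (ends '' (↑B : Set ι)) x) :
    openCluster (ends '' (↑(insert e B) : Set ι)) x = openCluster (ends '' (↑B : Set ι)) x := by
  have hcond : ∀ i ∈ ({e} : Finset ι), ∀ v ∈ ends i, v ≠ z → v ∉ openCluster (ends '' (↑B : Set ι)) x := by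
    intro i hi v hv hvz
    rw [Finset.mem_singleton] at hi
    subst hi
    rw [he, Sym2.mem_iff] at hv
    rcases hv with rfl | rfl
    · exact absurd rfl hvz
    · exact hu
  have h := openCluster_union_zEdges_eq ends (s₀ := B) (t := ({e} : Finset ι)) hz hcond
  -- transport along the set equality `↑(B ∪ {e}) = insert e ↑B` (the union in `h` carries the classical instance)
  obtain ⟨S, hS, hS'⟩ : ∃ S : Set ι, openCluster (ends '' S) x = openCluster (ends '' (↑B : Set ι)) x ∧ S = insert e (↑B : Set ι) :=
    ⟨_, h, by ext i; simp⟩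
  rw [Finset.coe_insert, ← hS']
  exact hS

open Classical in
/-- After adding an edge `e = {z, u}`, `z` stays outside the cluster of `x` iff `z` and `u` were outside it.
[cite: KozmaNitzan2024, §5.5 (context only; folklore)] -/
theorem not_mem_openCluster_insert_zEdge_iff {B : Finset ι} {e : ι} {x z u : V} (he : ends e = s(z, u)) :
    z ∉ openCluster (ends '' (↑(insert e B) : Set ι)) x ↔
      (z ∉ openCluster (ends '' (↑B : Set ι)) x ∧ u ∉ openCluster (ends '' (↑B : Set ι)) x) := by
  constructor
  · intro h
    refine ⟨fun hzB => h (openCluster_image_mono ends (Finset.subset_insert e B) x hzB), fun huB => h ?_⟩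
    have huI : u ∈ openCluster (ends '' (↑(insert e B) : Set ι)) x := openCluster_image_mono ends (Finset.subset_insert e B) x huB
    have he' : ends e = s(u, z) := by rw [he, Sym2.eq_swap]
    exact mem_openCluster_of_edge ends (Finset.mem_insert_self e B) he' huI
  · rintro ⟨hzB, huB⟩
    rw [openCluster_insert_zEdge_eq ends he hzB huB]
    exact hzB

end graph

section sums

variable [DecidableEq ι]

open Classical in
/-- **z-LOCALITY OF THE POINT ROW** (prim-lf-2 gen 33).  For an edge `e ∈ E` with ends `{z, u}`, a vertex `x` and ANY `g : Set V → ℝ`,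
`Σ_{s ⊆ E : z ∉ C_x(s), z ∉ C_x(E∖s)} (1[u ∈ C_x s] − 1[u ∈ C_x(E∖s)])·(g(C_x s) − g(C_x(E∖s)))` is unchanged when `e` is erased from `E`:
resolving the colour of `e`, a colouring `t` of `E ∖ e` survives the wall with `e` red iff additionally `u ∉ C_x(t)`, with `e` blue iff `u ∉ C_x((E∖e)∖t)`,
the clusters are then those of `t`, and `1[u ∉ C_x t]·(−1[u ∈ C_x t̄]) + 1[u ∉ C_x t̄]·1[u ∈ C_x t] = 1[u ∈ C_x t] − 1[u ∈ C_x t̄]` (`t̄ = (E∖e)∖t`).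
(The weight `2 − a_u − b_u` of CW-PROGRAMME (P4) acts as the identity on the point functional.)  [cite: KozmaNitzan2024, Questions 8–9 (§5.5 p. 36) (context)] -/
theorem pointRow_erase_zEdge (E : Finset ι) {e : ι} (he : e ∈ E) {x z u : V} (hends : ends e = s(z, u)) (g : Set V → ℝ) :
    ∑ s ∈ E.powerset.filter (fun s : Finset ι => z ∉ openCluster (ends '' (↑s : Set ι)) x ∧ z ∉ openCluster (ends '' (↑(E \ s) : Set ι)) x),
      ((if u ∈ openCluster (ends '' (↑s : Set ι)) x then (1 : ℝ) else 0) - (if u ∈ openCluster (ends '' (↑(E \ s) : Set ι)) x then (1 : ℝ) else 0)) *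
        (g (openCluster (ends '' (↑s : Set ι)) x) - g (openCluster (ends '' (↑(E \ s) : Set ι)) x)) =
    ∑ s ∈ (E.erase e).powerset.filter (fun s : Finset ι => z ∉ openCluster (ends '' (↑s : Set ι)) x ∧ z ∉ openCluster (ends '' (↑((E.erase e) \ s) : Set ι)) x),
      ((if u ∈ openCluster (ends '' (↑s : Set ι)) x then (1 : ℝ) else 0) - (if u ∈ openCluster (ends '' (↑((E.erase e) \ s) : Set ι)) x then (1 : ℝ) else 0)) *
        (g (openCluster (ends '' (↑s : Set ι)) x) - g (openCluster (ends '' (↑((E.erase e) \ s) : Set ι)) x)) := by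
  set K : Finset ι → Set V := fun s => openCluster (ends '' (↑s : Set ι)) x with hK
  set E' : Finset ι := E.erase e with hE'
  set ind : Set V → ℝ := fun S => if u ∈ S then (1 : ℝ) else 0 with hind
  change ∑ s ∈ E.powerset.filter (fun s : Finset ι => z ∉ K s ∧ z ∉ K (E \ s)), (ind (K s) - ind (K (E \ s))) * (g (K s) - g (K (E \ s))) =
    ∑ s ∈ E'.powerset.filter (fun s : Finset ι => z ∉ K s ∧ z ∉ K (E' \ s)), (ind (K s) - ind (K (E' \ s))) * (g (K s) - g (K (E' \ s)))
  have heE' : e ∉ E' := Finset.notMem_erase e E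
  have hE : E = insert e E' := (Finset.insert_erase he).symm
  -- the two bookkeeping identities for complements
  have c1 : ∀ t, t ⊆ E' → (insert e E') \ t = insert e (E' \ t) := by
    intro t ht
    ext i
    simp only [Finset.mem_sdiff, Finset.mem_insert]
    constructor
    · rintro ⟨hi | hi, hni⟩
      · exact Or.inl hi
      · exact Or.inr ⟨hi, hni⟩
    · rintro (rfl | ⟨hi, hni⟩)
      · exact ⟨Or.inl rfl, fun h => heE' (ht h)⟩
      · exact ⟨Or.inr hi, hni⟩
  have c2 : ∀ t, t ⊆ E' → (insert e E') \ (insert e t) = E' \ t := by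
    intro t _
    ext i
    simp only [Finset.mem_sdiff, Finset.mem_insert, not_or]
    constructor
    · rintro ⟨hi | hi, hne, hni⟩
      · exact absurd hi hne
      · exact ⟨hi, hni⟩
    · rintro ⟨hi, hni⟩
      exact ⟨Or.inr hi, fun h => heE' (h ▸ hi), hni⟩
  rw [Finset.sum_filter, Finset.sum_filter, hE, Finset.sum_powerset_insert heE', ← Finset.sum_add_distrib]
  refine Finset.sum_congr rfl fun t ht => ?_
  have htE' : t ⊆ E' := Finset.mem_powerset.mp ht
  rw [c1 t htE', c2 t htE']
  set B : Finset ι := E' \ t with hB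
  -- the wall conditions after resolving the colour of `e`
  have h1 : z ∉ K (insert e B) ↔ (z ∉ K B ∧ u ∉ K B) := not_mem_openCluster_insert_zEdge_iff ends hends
  have h2 : z ∉ K (insert e t) ↔ (z ∉ K t ∧ u ∉ K t) := not_mem_openCluster_insert_zEdge_iff ends hends
  by_cases hzt : z ∈ K t
  · have hzt' : ¬ (z ∉ K (insert e t)) := fun h => (h2.mp h).1 hzt
    simp [hzt, hzt']
  by_cases hzB : z ∈ K B
  · have hzB' : ¬ (z ∉ K (insert e B)) := fun h => (h1.mp h).1 hzB
    simp [hzB, hzB']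
  by_cases hut : u ∈ K t
  · have hA' : ¬ (z ∉ K (insert e t)) := fun h => (h2.mp h).2 hut
    by_cases huB : u ∈ K B
    · have hA : ¬ (z ∉ K (insert e B)) := fun h => (h1.mp h).2 huB
      simp [hzt, hzB, hut, huB, hA, hA', hind]
    · have hKB : K (insert e B) = K B := openCluster_insert_zEdge_eq ends hends hzB huB
      have hA : z ∉ K (insert e B) := h1.mpr ⟨hzB, huB⟩
      simp [hzt, hzB, hut, huB, hA', hKB, hind]
  · by_cases huB : u ∈ K B
    · have hA : ¬ (z ∉ K (insert e B)) := fun h => (h1.mp h).2 huB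
      have hKt : K (insert e t) = K t := openCluster_insert_zEdge_eq ends hends hzt hut
      have hA' : z ∉ K (insert e t) := h2.mpr ⟨hzt, hut⟩
      simp [hzt, hzB, hut, huB, hA, hKt, hind]
    · have hKB : K (insert e B) = K B := openCluster_insert_zEdge_eq ends hends hzB huB
      have hKt : K (insert e t) = K t := openCluster_insert_zEdge_eq ends hends hzt hut
      have hA : z ∉ K (insert e B) := h1.mpr ⟨hzB, huB⟩
      have hA' : z ∉ K (insert e t) := h2.mpr ⟨hzt, hut⟩
      simp [hzt, hzB, hut, huB, hKB, hKt, hind]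

open Classical in
/-- z-locality for a SET of edges: erasing any set `Z ⊆ E` of edges with ends `{z, u}` does not change
`Σ_{s ⊆ E : z ∉ C_x(s), z ∉ C_x(E∖s)} (1[u ∈ C_x s] − 1[u ∈ C_x(E∖s)])·(g(C_x s) − g(C_x(E∖s)))` (induction on `Z` with `pointRow_erase_zEdge`).
[cite: KozmaNitzan2024, Questions 8–9 (§5.5 p. 36) (context)] -/
theorem pointRow_sdiff_zEdges (E Z : Finset ι) (hZ : Z ⊆ E) {x z u : V} (hZe : ∀ i ∈ Z, ends i = s(z, u)) (g : Set V → ℝ) :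
    ∑ s ∈ E.powerset.filter (fun s : Finset ι => z ∉ openCluster (ends '' (↑s : Set ι)) x ∧ z ∉ openCluster (ends '' (↑(E \ s) : Set ι)) x),
      ((if u ∈ openCluster (ends '' (↑s : Set ι)) x then (1 : ℝ) else 0) - (if u ∈ openCluster (ends '' (↑(E \ s) : Set ι)) x then (1 : ℝ) else 0)) *
        (g (openCluster (ends '' (↑s : Set ι)) x) - g (openCluster (ends '' (↑(E \ s) : Set ι)) x)) =
    ∑ s ∈ (E \ Z).powerset.filter (fun s : Finset ι => z ∉ openCluster (ends '' (↑s : Set ι)) x ∧ z ∉ openCluster (ends '' (↑((E \ Z) \ s) : Set ι)) x),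
      ((if u ∈ openCluster (ends '' (↑s : Set ι)) x then (1 : ℝ) else 0) - (if u ∈ openCluster (ends '' (↑((E \ Z) \ s) : Set ι)) x then (1 : ℝ) else 0)) *
        (g (openCluster (ends '' (↑s : Set ι)) x) - g (openCluster (ends '' (↑((E \ Z) \ s) : Set ι)) x)) := by
  induction Z using Finset.induction_on with
  | empty => simp only [Finset.sdiff_empty]
  | @insert i Z' hi IH =>
    have hZ' : Z' ⊆ E := fun j hj => hZ (Finset.mem_insert_of_mem hj)
    have hiE : i ∈ E \ Z' := Finset.mem_sdiff.mpr ⟨hZ (Finset.mem_insert_self i Z'), hi⟩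
    rw [IH hZ' (fun j hj => hZe j (Finset.mem_insert_of_mem hj)), Finset.sdiff_insert,
      pointRow_erase_zEdge ends (E \ Z') hiE (hZe i (Finset.mem_insert_self i Z')) g]

variable [Fintype ι]

open Classical in
/-- **The point row holds when the wall vertex sees only the two points.**  Let `E` be a finite edge set, `x ≠ z`, and suppose every edge of `E` at `z`
has ends `{z, u}` or `{z, w}` (any multiplicities; `u = w` allowed).  Then
`0 ≤ Σ_{s ⊆ E : z ∉ C_x(s), z ∉ C_x(E∖s)} (1[u ∈ C_x s] − 1[u ∈ C_x(E∖s)])·(1[w ∈ C_x s] − 1[w ∈ C_x(E∖s)])`,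
i.e. `#W{u,w ∈ K} ≥ #W{u ∈ K, w ∈ K̄}` for the wall `W` = 'no monochromatic `x–z` path'.  Proof: erase the edges at `z` (`pointRow_sdiff_zEdges`, twice);
the wall becomes vacuous and the sum is Harris' inequality in two-colouring form (`harris_twoColouring_powerset`).
[cite: KozmaNitzan2024, Questions 8–9 (§5.5 p. 36) (context)] -/
theorem pointRow_nonneg_of_zEdges (E : Finset ι) {x z : V} (hzx : z ≠ x) (u w : V)
    (hN : ∀ i ∈ E, z ∈ ends i → (ends i = s(z, u) ∨ ends i = s(z, w))) :
    0 ≤ ∑ s ∈ E.powerset.filter (fun s : Finset ι => z ∉ openCluster (ends '' (↑s : Set ι)) x ∧ z ∉ openCluster (ends '' (↑(E \ s) : Set ι)) x),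
      ((if u ∈ openCluster (ends '' (↑s : Set ι)) x then (1 : ℝ) else 0) - (if u ∈ openCluster (ends '' (↑(E \ s) : Set ι)) x then (1 : ℝ) else 0)) *
        ((if w ∈ openCluster (ends '' (↑s : Set ι)) x then (1 : ℝ) else 0) - (if w ∈ openCluster (ends '' (↑(E \ s) : Set ι)) x then (1 : ℝ) else 0)) := by
  set K : Finset ι → Set V := fun s => openCluster (ends '' (↑s : Set ι)) x with hK
  -- erase the edges `{z,u}`
  set Zu : Finset ι := E.filter (fun i => ends i = s(z, u)) with hZu
  have hZuE : Zu ⊆ E := Finset.filter_subset _ _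
  have hZue : ∀ i ∈ Zu, ends i = s(z, u) := fun i hi => (Finset.mem_filter.mp hi).2
  rw [pointRow_sdiff_zEdges ends E Zu hZuE hZue (fun S => if w ∈ S then (1 : ℝ) else 0)]
  set E₁ : Finset ι := E \ Zu with hE₁
  -- swap the two factors and erase the edges `{z,w}`
  set Zw : Finset ι := E₁.filter (fun i => ends i = s(z, w)) with hZw
  have hZwE : Zw ⊆ E₁ := Finset.filter_subset _ _
  have hZwe : ∀ i ∈ Zw, ends i = s(z, w) := fun i hi => (Finset.mem_filter.mp hi).2
  have hswap : ∀ F : Finset ι, ∑ s ∈ F.powerset.filter (fun s : Finset ι => z ∉ K s ∧ z ∉ K (F \ s)),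
      ((if u ∈ K s then (1 : ℝ) else 0) - (if u ∈ K (F \ s) then (1 : ℝ) else 0)) * ((if w ∈ K s then (1 : ℝ) else 0) - (if w ∈ K (F \ s) then (1 : ℝ) else 0)) =
      ∑ s ∈ F.powerset.filter (fun s : Finset ι => z ∉ K s ∧ z ∉ K (F \ s)),
      ((if w ∈ K s then (1 : ℝ) else 0) - (if w ∈ K (F \ s) then (1 : ℝ) else 0)) * ((if u ∈ K s then (1 : ℝ) else 0) - (if u ∈ K (F \ s) then (1 : ℝ) else 0)) :=
    fun F => Finset.sum_congr rfl fun s _ => mul_comm _ _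
  change 0 ≤ ∑ s ∈ E₁.powerset.filter (fun s : Finset ι => z ∉ K s ∧ z ∉ K (E₁ \ s)),
      ((if u ∈ K s then (1 : ℝ) else 0) - (if u ∈ K (E₁ \ s) then (1 : ℝ) else 0)) * ((if w ∈ K s then (1 : ℝ) else 0) - (if w ∈ K (E₁ \ s) then (1 : ℝ) else 0))
  rw [hswap E₁]
  have step2 := pointRow_sdiff_zEdges ends E₁ Zw hZwE (x := x) hZwe (fun S => if u ∈ S then (1 : ℝ) else 0)
  change ∑ s ∈ E₁.powerset.filter (fun s : Finset ι => z ∉ K s ∧ z ∉ K (E₁ \ s)),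
      ((if w ∈ K s then (1 : ℝ) else 0) - (if w ∈ K (E₁ \ s) then (1 : ℝ) else 0)) * ((if u ∈ K s then (1 : ℝ) else 0) - (if u ∈ K (E₁ \ s) then (1 : ℝ) else 0)) =
    ∑ s ∈ (E₁ \ Zw).powerset.filter (fun s : Finset ι => z ∉ K s ∧ z ∉ K ((E₁ \ Zw) \ s)),
      ((if w ∈ K s then (1 : ℝ) else 0) - (if w ∈ K ((E₁ \ Zw) \ s) then (1 : ℝ) else 0)) * ((if u ∈ K s then (1 : ℝ) else 0) - (if u ∈ K ((E₁ \ Zw) \ s) then (1 : ℝ) else 0)) at step2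
  rw [step2]
  set E₂ : Finset ι := E₁ \ Zw with hE₂
  -- no edge of `E₂` contains `z`, so the wall is vacuous on `E₂`
  have hnoz : ∀ i ∈ E₂, z ∉ ends i := by
    intro i hi hzi
    have hi₁ : i ∈ E₁ := (Finset.mem_sdiff.mp hi).1
    have hiE : i ∈ E := (Finset.mem_sdiff.mp hi₁).1
    rcases hN i hiE hzi with h | h
    · exact (Finset.mem_sdiff.mp hi₁).2 (Finset.mem_filter.mpr ⟨hiE, h⟩)
    · exact (Finset.mem_sdiff.mp hi).2 (Finset.mem_filter.mpr ⟨hi₁, h⟩)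
  have hwall : ∀ s ∈ E₂.powerset, z ∉ K s ∧ z ∉ K (E₂ \ s) := by
    intro s hs
    have hsE : s ⊆ E₂ := Finset.mem_powerset.mp hs
    exact ⟨not_mem_openCluster_of_forall_not_mem ends (fun i hi => hnoz i (hsE hi)) hzx,
      not_mem_openCluster_of_forall_not_mem ends (fun i hi => hnoz i (Finset.sdiff_subset hi)) hzx⟩
  rw [Finset.filter_true_of_mem hwall]
  -- Harris in two-colouring form
  have hmono : ∀ v : V, Monotone (fun s : Finset ι => if v ∈ K s then (1 : ℝ) else 0) := by
    intro v a b hab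
    by_cases ha : v ∈ K a
    · have hb : v ∈ K b := openCluster_image_mono ends hab x ha
      simp [ha, hb]
    · by_cases hb : v ∈ K b
      · simp [ha, hb]
      · simp [ha, hb]
  exact harris_twoColouring_powerset E₂ (fun s => if w ∈ K s then (1 : ℝ) else 0) (fun s => if u ∈ K s then (1 : ℝ) else 0) (hmono w) (hmono u)

open Classical in
/-- **The point row over all colourings, wall vertex seeing only the two points.**  If `x ≠ z` and every edge of the multigraph at `z` has ends
`{z,u}` or `{z,w}`, then `0 ≤ Σ_{s : z ∉ C_x(s), z ∉ C_x(sᶜ)} σ_u(s)·σ_w(s)` with `σ_v(s) = 1[v ∈ C_x s] − 1[v ∈ C_x sᶜ]`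
(`pointRow_nonneg_of_zEdges` with `E = univ`).  [cite: KozmaNitzan2024, Questions 8–9 (§5.5 p. 36) (context)] -/
theorem pointRow_univ_nonneg_of_zEdges {x z : V} (hzx : z ≠ x) (u w : V)
    (hN : ∀ i, z ∈ ends i → (ends i = s(z, u) ∨ ends i = s(z, w))) :
    0 ≤ ∑ s ∈ univ.filter (fun s : Finset ι => z ∉ openCluster (ends '' (↑s : Set ι)) x ∧ z ∉ openCluster (ends '' (↑(sᶜ) : Set ι)) x),
      ((if u ∈ openCluster (ends '' (↑s : Set ι)) x then (1 : ℝ) else 0) - (if u ∈ openCluster (ends '' (↑(sᶜ) : Set ι)) x then (1 : ℝ) else 0)) *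
        ((if w ∈ openCluster (ends '' (↑s : Set ι)) x then (1 : ℝ) else 0) - (if w ∈ openCluster (ends '' (↑(sᶜ) : Set ι)) x then (1 : ℝ) else 0)) := by
  have key := pointRow_nonneg_of_zEdges ends (univ : Finset ι) hzx u w (fun i _ hzi => hN i hzi)
  simp only [Finset.powerset_univ, ← Finset.compl_eq_univ_sdiff] at key
  exact key

end sums

end Coefficientwise

end Summit.CriticalPhenomena.PercolationContinuityZ3.Theorems
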